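import Literature.Probability.RandomPlanarGeometry.SLETraceDensity
import Literature.Probability.RandomPlanarGeometry.LoewnerDerivRatio
import HarnessLib

/-!
# The limit `Z(z)` of Rohde–Schramm's Lemma 6.3 exists; `Z = ∞` iff `∫₀^τ 4y²/|z|⁴ = ∞`

Trunk T-STOCH; layer 3b of the decomposition of the space-filling phase of SLE_κ
(`Literature.Probability.RandomPlanarGeometry.ae_isSpaceFilling_sleTrace_of_eight_le`; Rohde–Schramm, Ann. Math. 161 (2005),
Cor. 7.4 + Update, p. 911). Layer 2 (`SLETraceDensity.lean`) reduced it to the four core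
theorems, among them **Lemma 6.3, case `κ ≥ 8`** (p. 903), vendored as the named fact
`Literature.Probability.RandomPlanarGeometry.tendsto_sleDerivRatio_atTop_of_eight_le`: for `z ∈ ℍ`, a.s.
`Z(z) = lim_{t ↑ τ(z)} y |gₜ'(z)| / Im gₜ(z) = ∞`. Layer 3a (`LoewnerDerivRatio.lean`) proved
eq. (6.3), `y |gₜ'(z)| / Im gₜ(z) = exp ∫₀ᵗ 4 yₛ² |zₛ|⁻⁴ ds`, for every continuous driving
function. Here we draw the consequences for the SLE_κ flow `gₜ = sleMap κ ω t` (driving function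
`√κ B(ω)`, continuous for every `ω`):

* `Literature.Probability.RandomPlanarGeometry.sleDerivRatio_eq_exp` — (6.3) for SLE: `sleDerivRatio κ ω z t = exp ∫₀ᵗ (rate)`,
  `t < τ(z)`; hence `1 ≤ sleDerivRatio` and monotonicity in `t` (`one_le_sleDerivRatio`,
  `sleDerivRatio_mono`, `monotone_sleDerivRatio`);
* `Literature.Probability.RandomPlanarGeometry.tendsto_sleDerivRatio_atTop_or_exists_tendsto` — **the first assertion of Lemma 6.3,
  proved for every path**: the limit `Z(z) ∈ [1, ∞]` exists ("In particular, the limit in the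
  definition of `Z` exists a.s.", p. 904), i.e. the ratio tends to `+∞` or to a finite `L ≥ 1`
  as `t ↑ τ(z)`;
* `Literature.Probability.RandomPlanarGeometry.tendsto_sleDerivRatio_atTop_iff` — pathwise, **`Z(z) = ∞` iff
  `∫₀ᵗ 4 yₛ² |zₛ|⁻⁴ ds → ∞` as `t ↑ τ(z)`**;
* `Literature.Probability.RandomPlanarGeometry.tendsto_integral_derivRatioRate_atTop_of_eight_le` — the second assertion of Lemma 6.3
  for `κ ≥ 8` restated through (6.3) as the a.s. divergence of `∫₀^{τ(z)} 4 yₛ² |zₛ|⁻⁴ ds`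
  (named fact), and `Literature.Probability.RandomPlanarGeometry.tendsto_sleDerivRatio_atTop_of_eight_le_iff` — **proved equivalent** to
  the layer-2 fact. Either form is the remaining stochastic input (the printed proof: the local
  martingale `Mₜ = (ŷ |gₜ'(ẑ)|/yₜ)^a Ĝ(zₜ)`, optional sampling, `Ĝ_{1-κ/8,κ}(1) = ∞` for `κ > 8`,
  the coefficient estimate for `κ = 8`; pp. 904–906).

## References

* S. Rohde, O. Schramm, *Basic properties of SLE*, Ann. of Math. 161 (2005) 883–924: Lemma 6.3
  and eqs. (6.3), (6.4) (pp. 903–905); (3.9) (p. 891).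
-/

noncomputable section

open Set Filter Topology Metric MeasureTheory
open UpperHalfPlane (upperHalfPlaneSet isOpen_upperHalfPlaneSet)
open scoped NNReal

namespace Literature.Probability.RandomPlanarGeometry

section SLE

variable (κ : ℝ≥0) (ω : ℝ≥0 → ℝ) {z : ℂ}

/-- **Rohde–Schramm (2005), eq. (6.3), for the SLE_κ flow**: for `z ∈ ℍ` and `t < τ(z)`,
`sleDerivRatio κ ω z t = (Im z) |gₜ'(z)| / Im gₜ(z) = exp ∫₀ᵗ 4 yₛ² |zₛ|⁻⁴ ds`
(`Loewner.im_mul_norm_deriv_map_div_im_eq_exp` for the continuous driving function `√κ B(ω)`).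
[cite: RohdeSchramm2005, eq. (6.3)] -/
theorem sleDerivRatio_eq_exp (hz : z ∈ upperHalfPlaneSet) {t : ℝ≥0}
    (ht : (t : WithTop ℝ≥0) < Loewner.swallowingTime (sleDriving κ ω) z) :
    sleDerivRatio κ ω z t =
      Real.exp (∫ s in (0:ℝ)..t, Loewner.derivRatioRate (sleDriving κ ω) z s) :=
  Loewner.im_mul_norm_deriv_map_div_im_eq_exp (continuous_sleDriving κ ω) hz ht

/-- `1 ≤ (Im z) |gₜ'(z)| / Im gₜ(z)` for `t < τ(z)`; Rohde–Schramm (2005), proof of Lemma 6.3,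
"Note that `1 ≤ ŷ |g_T'(ẑ)|/y_T < Z`" (p. 905). [cite: RohdeSchramm2005, Lemma 6.3] -/
theorem one_le_sleDerivRatio (hz : z ∈ upperHalfPlaneSet) {t : ℝ≥0}
    (ht : (t : WithTop ℝ≥0) < Loewner.swallowingTime (sleDriving κ ω) z) :
    1 ≤ sleDerivRatio κ ω z t :=
  Loewner.one_le_im_mul_norm_deriv_map_div_im (continuous_sleDriving κ ω) hz ht

/-- The ratio `(Im z) |gₜ'(z)| / Im gₜ(z)` is non-decreasing in `t < τ(z)` (by (6.3)).
[cite: RohdeSchramm2005, eq. (6.3)] -/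
theorem sleDerivRatio_mono (hz : z ∈ upperHalfPlaneSet) {s t : ℝ≥0} (hst : s ≤ t)
    (ht : (t : WithTop ℝ≥0) < Loewner.swallowingTime (sleDriving κ ω) z) :
    sleDerivRatio κ ω z s ≤ sleDerivRatio κ ω z t :=
  Loewner.im_mul_norm_deriv_map_div_im_mono (continuous_sleDriving κ ω) hz hst ht

/-- Monotonicity of the ratio on the time interval `[0, τ(z))`. [cite: RohdeSchramm2005, eq. (6.3)] -/
theorem monotone_sleDerivRatio (hz : z ∈ upperHalfPlaneSet) :
    Monotone fun t : {t : ℝ≥0 // (t : WithTop ℝ≥0) < Loewner.swallowingTime (sleDriving κ ω) z} ↦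
      sleDerivRatio κ ω z t :=
  fun _ b hab ↦ sleDerivRatio_mono κ ω hz hab b.2

/-- **Rohde–Schramm (2005), Lemma 6.3, first assertion — the limit `Z(z)` exists — proved for
every path** ("Let `κ > 0` and `z = x + iy ∈ ℍ`. Then the limit
`Z(z) := lim_{t ↑ τ(z)} y |gₜ'(z)| / Im gₜ(z)` exists a.s."; by (6.3), "In particular, the limit
in the definition of `Z` exists", p. 904): the ratio being non-decreasing and `≥ 1`, as
`t ↑ τ(z)` it either tends to `+∞` or to a finite limit `L ≥ 1`. (The time interval
`{t | ↑t < τ(z)}` is nonempty, `τ(z) > 0`.) [cite: RohdeSchramm2005, Lemma 6.3] -/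
theorem tendsto_sleDerivRatio_atTop_or_exists_tendsto (hz : z ∈ upperHalfPlaneSet) :
    Tendsto (fun t : {t : ℝ≥0 // (t : WithTop ℝ≥0) < Loewner.swallowingTime (sleDriving κ ω) z} ↦
        sleDerivRatio κ ω z t) atTop atTop ∨
      ∃ L : ℝ, 1 ≤ L ∧ Tendsto
        (fun t : {t : ℝ≥0 // (t : WithTop ℝ≥0) < Loewner.swallowingTime (sleDriving κ ω) z} ↦
          sleDerivRatio κ ω z t) atTop (𝓝 L) := by
  have hzim : 0 < z.im := hz
  have hzW : z ≠ sleDriving κ ω 0 := by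
    intro h
    have : z.im = 0 := by rw [h, Complex.ofReal_im]
    exact hzim.ne' this
  have h0 : ((0 : ℝ≥0) : WithTop ℝ≥0) < Loewner.swallowingTime (sleDriving κ ω) z :=
    Loewner.swallowingTime_pos_holds (continuous_sleDriving κ ω) hzW
  haveI : Nonempty {t : ℝ≥0 // (t : WithTop ℝ≥0) < Loewner.swallowingTime (sleDriving κ ω) z} :=
    ⟨⟨0, h0⟩⟩
  rcases tendsto_atTop_of_monotone (monotone_sleDerivRatio κ ω hz) with h | ⟨L, hL⟩
  · exact Or.inl h
  · refine Or.inr ⟨L, ?_, hL⟩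
    exact ge_of_tendsto' hL fun t ↦ one_le_sleDerivRatio κ ω hz t.2

/-- **`Z(z) = ∞` iff `∫₀ᵗ 4 yₛ² |zₛ|⁻⁴ ds → ∞` as `t ↑ τ(z)`**, for every path (by (6.3),
`exp` tending to `∞` iff its argument does). Rohde–Schramm (2005), (6.3)/(6.4).
[cite: RohdeSchramm2005, eq. (6.3)] -/
theorem tendsto_sleDerivRatio_atTop_iff (hz : z ∈ upperHalfPlaneSet) :
    Tendsto (fun t : {t : ℝ≥0 // (t : WithTop ℝ≥0) < Loewner.swallowingTime (sleDriving κ ω) z} ↦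
        sleDerivRatio κ ω z t) atTop atTop ↔
      Tendsto (fun t : {t : ℝ≥0 // (t : WithTop ℝ≥0) < Loewner.swallowingTime (sleDriving κ ω) z} ↦
        ∫ s in (0:ℝ)..(t : ℝ≥0), Loewner.derivRatioRate (sleDriving κ ω) z s) atTop atTop := by
  have heq : (fun t : {t : ℝ≥0 // (t : WithTop ℝ≥0) < Loewner.swallowingTime (sleDriving κ ω) z} ↦
      sleDerivRatio κ ω z t) =
      fun t : {t : ℝ≥0 // (t : WithTop ℝ≥0) < Loewner.swallowingTime (sleDriving κ ω) z} ↦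
        Real.exp (∫ s in (0:ℝ)..(t : ℝ≥0), Loewner.derivRatioRate (sleDriving κ ω) z s) :=
    funext fun t ↦ sleDerivRatio_eq_exp κ ω hz t.2
  rw [heq, Real.tendsto_exp_comp_atTop]

end SLE

/-- **Rohde–Schramm (2005), Lemma 6.3, case `κ ≥ 8`, in the integrated form (6.3)**: for `κ ≥ 8`
and `z ∈ ℍ`, almost surely `∫₀ᵗ 4 yₛ² |zₛ|⁻⁴ ds → ∞` as `t ↑ τ(z)` (through the time interval
`{t | ↑t < τ(z)}`), `zₛ = xₛ + i yₛ = gₛ(z) - Wₛ`; i.e. `log Z(z) = ∫₀^{τ(z)} 4 yₜ² |zₜ|⁻⁴ dt = ∞`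
((6.3), p. 904, combined with "`Z(z) = ∞` a.s. if `κ ≥ 8`", Lemma 6.3, p. 903). Proved below to
be equivalent to the vendored form `tendsto_sleDerivRatio_atTop_of_eight_le` of the lemma.
[cite: RohdeSchramm2005, Lemma 6.3 and eq. (6.3)] -/
def tendsto_integral_derivRatioRate_atTop_of_eight_le : Prop :=
  ∀ {κ : ℝ≥0}, 8 ≤ κ → ∀ z ∈ upperHalfPlaneSet, ∀ᵐ ω ∂Process.preWienerMeasure,
    Tendsto (fun t : {t : ℝ≥0 // (t : WithTop ℝ≥0) < Loewner.swallowingTime (sleDriving κ ω) z} ↦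
      ∫ s in (0:ℝ)..(t : ℝ≥0), Loewner.derivRatioRate (sleDriving κ ω) z s) atTop atTop

/-- **The two forms of Lemma 6.3 (`κ ≥ 8`) are equivalent** (by (6.3), pathwise:
`tendsto_sleDerivRatio_atTop_iff`). [cite: RohdeSchramm2005, Lemma 6.3 and eq. (6.3)] -/
theorem tendsto_sleDerivRatio_atTop_of_eight_le_iff :
    tendsto_sleDerivRatio_atTop_of_eight_le ↔ tendsto_integral_derivRatioRate_atTop_of_eight_le := by
  constructor
  · intro h κ hκ z hz
    filter_upwards [h hκ z hz] with ω hω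
    exact (tendsto_sleDerivRatio_atTop_iff κ ω hz).1 hω
  · intro h κ hκ z hz
    filter_upwards [h hκ z hz] with ω hω
    exact (tendsto_sleDerivRatio_atTop_iff κ ω hz).2 hω

section CritPerc

/-- **crit-perc.S20, space-filling phase, with Lemma 6.3 in the integral form (6.3)**:
`ae_isSpaceFilling_sleTrace_of_eight_le` from SLE₈ being a curve (LSW04 Thm 4.7, `h8`), the
Rohde–Schramm theorem (RS05 Thm 5.1, `hne`), transience (RS05 Thm 7.1 + Update, `htr`) and the
a.s. divergence of `∫₀^{τ(z)} 4 yₛ² |zₛ|⁻⁴ ds` for `κ ≥ 8` (`hI`); (6.2), (6.3) and all topology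
are proved. [cite: RohdeSchramm2005, Cor. 7.4 and Update (p. 911)] -/
theorem ae_isSpaceFilling_sleTrace_of_eight_le_of_core_facts_integral (h8 : hasSLETrace_eight)
    (hne : hasSLETrace_of_ne_eight) (htr : tendsto_norm_sleTrace_atTop)
    (hI : tendsto_integral_derivRatioRate_atTop_of_eight_le) {κ : ℝ≥0} :
    ae_isSpaceFilling_sleTrace_of_eight_le (κ := κ) :=
  ae_isSpaceFilling_sleTrace_of_eight_le_of_core_facts h8 hne htr
    (tendsto_sleDerivRatio_atTop_of_eight_le_iff.2 hI)

end CritPerc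

end Literature.Probability.RandomPlanarGeometry

end
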